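import Mathlib
import Summits.NavierStokesRegularity.NavierStokesRegularity.Theorems.EulerZoomLiouvillePowerGaugeEulerLiouvilleDSSEndpointSlices
import Summits.NavierStokesRegularity.NavierStokesRegularity.Theorems.EulerZoomLiouvillePowerGaugeEulerLiouvilleSelfSimilarEndpointPressureIdentification
import HarnessLib

/-!
# Rung C2 of the crux `EulerZoomLiouville.PowerGaugeEulerLiouville` at the endpoint `ρ = 1/2`:
# the Riesz representation of a.e. slice pressure, from the class

Route №10 `EulerZoomLiouville` (NavierStokesRegularity), crux E = stmt-NavierStokesRegularity-19832,
tenure rung C2 (`Sig.rungC2_dss`) at the energy-conserving endpoint `ρ = 1/2`.  For a member of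
Seregin's class at `ρ = 1/2` whose slices on a time interval `(α, β)` obey the sublinear far-field
bound `|u(τ, y)| ≤ C_up |y|^{1−δ}` (`|y| ≥ R₀`), a.e. slice pressure IS the scale-wise Riesz pressure
of the slice velocity: `p(τ) = Π[u(τ)·1_{B_R}] + ∫_{|z| ≥ R} K(·−z)(u(τ,z)) dz` a.e. on `B_{R/2}`, every
`R ≥ 1`.  This discharges, slice by slice, the pressure hypothesis of the DSS endpoint decay theorem
(`dss_half_periodEnergy_decay`), exactly as the lineage's `…SelfSimilarEndpointMemberFull` did for the
profile of an exactly self-similar member: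

* `setIntegral_abs_le_of_lintegral_ball` — Hölder `(3/2, 3)` on a ball;
* `ae_slice_pressure_growth_of_gauge_half` — the `D`-gauge `a D(a) ≤ c` makes the weighted dyadic
  series `Σ_k 4^{−k} ∫_{B_{2^{k+k₀}}} |p(τ)|^{3/2}` integrable in `τ`, hence a.e. finite:
  `∫_{B_L} |p(τ)|^{3/2} ≤ A_τ L²` (`L ≥ 1`) for a.e. slice;
* `ae_slice_riesz_of_gauge_half` — slice Poisson identity (tree
  `IsDistributionalNSSolutionOn.ae_forall_slice_pressure_identity`) + the growths
  `∫_{B_L}|p(τ)| ≲ L^{7/3}`, `∫_{B_L}|u(τ)|³ ≲ L^{5/3}` + the lineage's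
  `pressure_ae_eq_scaleQ_of_poisson` (`σ = 2/3`).

No self-similarity is used.  WHAT THIS IS NOT: not NS, not E, not rung C2 — bookkeeping for one
endpoint stratum.
-/

noncomputable section

-- flat `Theorems/<Route><Decl>…` files of one crux share the namespace of the crux (tree convention)
set_option linter.dupNamespace false

open MeasureTheory Set Filter Topology Metric Function TopologicalSpace
open scoped ENNReal NNReal InnerProductSpace RealInnerProductSpace Laplacian

namespace Summit.NavierStokesRegularity.NavierStokesRegularity.Theorems.PowerGaugeEulerLiouville

open Literature.Analysis Literature.Analysis.FunctionSpaces Literature.Analysis.FluidPDE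

section Holder

variable {P : EuclideanSpace ℝ (Fin 3) → ℝ}

/-- **Hölder `(3/2, 3)` on a ball**: `∫_{B_L} |P| ≤ M^{2/3} (L³ vol B₁)^{1/3}` when
`∫_{B_L} |P|^{3/2} ≤ M` (in `ℝ≥0∞`). [folklore] -/
theorem setIntegral_abs_le_of_lintegral_ball (hPm : AEStronglyMeasurable P volume) {M L : ℝ}
    (hM : 0 ≤ M) (hL : 0 < L)
    (hb : ∫⁻ y in ball (0 : EuclideanSpace ℝ (Fin 3)) L, ‖P y‖ₑ ^ (3 / 2 : ℝ) ≤ ENNReal.ofReal M) :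
    ∫ y in ball (0 : EuclideanSpace ℝ (Fin 3)) L, |P y| ≤
      M ^ (2 / 3 : ℝ) * (L ^ 3 * volume.real (ball (0 : EuclideanSpace ℝ (Fin 3)) 1)) ^ (1 / 3 : ℝ) := by
  set D : Set (EuclideanSpace ℝ (Fin 3)) := ball 0 L with hD
  haveI : IsFiniteMeasure (volume.restrict D) := isFiniteMeasure_restrict.2 measure_ball_lt_top.ne
  have hPL : MemLp P (3 / 2 : ℝ≥0∞) (volume.restrict D) := by
    refine ⟨hPm.restrict, ?_⟩
    rw [eLpNorm_eq_lintegral_rpow_enorm_toReal (by simp) (ENNReal.div_ne_top (by norm_num) (by norm_num))]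
    have htR : (3 / 2 : ℝ≥0∞).toReal = 3 / 2 := by norm_num
    rw [htR]
    refine ENNReal.rpow_lt_top_of_nonneg (by norm_num) (ne_of_lt ?_)
    exact lt_of_le_of_lt hb ENNReal.ofReal_lt_top
  have hpq : Real.HolderConjugate (3 / 2 : ℝ) 3 := by rw [Real.holderConjugate_iff]; norm_num
  have h32 : ENNReal.ofReal (3 / 2 : ℝ) = (3 / 2 : ℝ≥0∞) := by
    rw [ENNReal.ofReal_div_of_pos (by norm_num)]; simp
  have hf : MemLp (fun y => |P y|) (ENNReal.ofReal (3 / 2 : ℝ)) (volume.restrict D) := by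
    rw [h32]; exact hPL.norm
  have hg : MemLp (fun _ : EuclideanSpace ℝ (Fin 3) => (1 : ℝ)) (ENNReal.ofReal 3) (volume.restrict D) :=
    memLp_const 1
  have hH := integral_mul_le_Lp_mul_Lq_of_nonneg hpq (Eventually.of_forall fun y => abs_nonneg (P y))
    (Eventually.of_forall fun _ => zero_le_one) hf hg
  simp only [mul_one, Real.one_rpow, integral_const, smul_eq_mul, measureReal_restrict_apply_univ] at hH
  have hI : ∫ y in D, |P y| ^ (3 / 2 : ℝ) ≤ M := by
    have hnn : 0 ≤ᵐ[volume.restrict D] fun y => |P y| ^ (3 / 2 : ℝ) :=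
      Eventually.of_forall fun y => by positivity
    have hmeas : AEStronglyMeasurable (fun y => |P y| ^ (3 / 2 : ℝ)) (volume.restrict D) :=
      (hPm.restrict.aemeasurable.norm.pow_const (3 / 2 : ℝ)).aestronglyMeasurable.congr
        (Eventually.of_forall fun y => by simp [Real.norm_eq_abs])
    rw [integral_eq_lintegral_of_nonneg_ae hnn hmeas]
    have e : ∀ y, ENNReal.ofReal (|P y| ^ (3 / 2 : ℝ)) = ‖P y‖ₑ ^ (3 / 2 : ℝ) := fun y => by
      rw [← ENNReal.ofReal_rpow_of_nonneg (abs_nonneg _) (by norm_num), ← Real.enorm_eq_ofReal_abs]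
    simp_rw [e]
    rw [← ENNReal.toReal_ofReal hM]
    exact ENNReal.toReal_mono ENNReal.ofReal_ne_top hb
  have hvol : volume.real D = L ^ 3 * volume.real (ball (0 : EuclideanSpace ℝ (Fin 3)) 1) := by
    change (volume (ball (0 : EuclideanSpace ℝ (Fin 3)) L)).toReal =
      L ^ 3 * (volume (ball (0 : EuclideanSpace ℝ (Fin 3)) 1)).toReal
    rw [Measure.addHaar_ball_of_pos volume (0 : EuclideanSpace ℝ (Fin 3)) hL,
      finrank_euclideanSpace_fin, ENNReal.toReal_mul, ENNReal.toReal_ofReal (by positivity)]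
  have hI0 : 0 ≤ ∫ y in D, |P y| ^ (3 / 2 : ℝ) := setIntegral_nonneg measurableSet_ball fun y _ => by positivity
  calc ∫ y in D, |P y| ≤ (∫ y in D, |P y| ^ (3 / 2 : ℝ)) ^ (1 / (3 / 2 : ℝ)) * (volume.real D) ^ (1 / (3 : ℝ)) := hH
    _ ≤ M ^ (2 / 3 : ℝ) * (L ^ 3 * volume.real (ball (0 : EuclideanSpace ℝ (Fin 3)) 1)) ^ (1 / 3 : ℝ) := by
        rw [show (1 : ℝ) / (3 / 2) = 2 / 3 by norm_num, hvol]
        gcongr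

end Holder

section PressureGrowth

variable {u : ℝ → EuclideanSpace ℝ (Fin 3) → EuclideanSpace ℝ (Fin 3)}
  {p : ℝ → EuclideanSpace ℝ (Fin 3) → ℝ}

/-- **The `D`-gauge on a window × ball at the endpoint:** `a D(a; 0) ≤ c` gives
`∫∫_{(α,β) × B_a} |p|^{3/2} ≤ c a` whenever `−a² ≤ α`, `β ≤ 0` (the window × ball lies in the
parabolic cylinder `Q_a(0,0)`). [folklore] -/
theorem lintegral_window_ball_rpow_le_of_gaugeD_half {c : ℝ≥0}
    (hD : ∀ a : ℝ, 0 < a →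
      ENNReal.ofReal (a ^ (2 * (1 / 2 : ℝ))) * cknD a (0 : ℝ × EuclideanSpace ℝ (Fin 3)) p ≤ (c : ℝ≥0∞))
    {a α β : ℝ} (ha : 0 < a) (hα : -(a ^ 2) ≤ α) (hβ : β ≤ 0) :
    ∫⁻ z in Ioo α β ×ˢ ball (0 : EuclideanSpace ℝ (Fin 3)) a, ‖p z.1 z.2‖ₑ ^ (3 / 2 : ℝ) ≤
      ENNReal.ofReal (c * a) := by
  have hSQ : Ioo α β ×ˢ ball (0 : EuclideanSpace ℝ (Fin 3)) a ⊆
      parabolicCylinder a (0 : ℝ × EuclideanSpace ℝ (Fin 3)) := by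
    intro z hz
    simp only [parabolicCylinder, mem_prod, mem_Ioo, mem_ball, Prod.fst_zero, Prod.snd_zero,
      zero_sub] at hz ⊢
    exact ⟨⟨lt_of_le_of_lt hα hz.1.1, lt_of_lt_of_le hz.1.2 hβ⟩, hz.2⟩
  have h1 := hD a ha
  have hpos : 0 < a ^ (2 * (1 / 2 : ℝ)) * (a ^ 2)⁻¹ := by positivity
  have hcoef : ENNReal.ofReal (a ^ (2 * (1 / 2 : ℝ))) * (ENNReal.ofReal a ^ 2)⁻¹ =
      ENNReal.ofReal (a ^ (2 * (1 / 2 : ℝ)) * (a ^ 2)⁻¹) := by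
    rw [← ENNReal.ofReal_pow ha.le, ← ENNReal.ofReal_inv_of_pos (by positivity),
      ← ENNReal.ofReal_mul (Real.rpow_nonneg ha.le _)]
  unfold cknD at h1
  rw [← mul_assoc, hcoef] at h1
  have h2 : ∫⁻ q in parabolicCylinder a (0 : ℝ × EuclideanSpace ℝ (Fin 3)), ‖p q.1 q.2‖ₑ ^ (3 / 2 : ℝ) ≤
      (c : ℝ≥0∞) / ENNReal.ofReal (a ^ (2 * (1 / 2 : ℝ)) * (a ^ 2)⁻¹) := by
    rw [ENNReal.le_div_iff_mul_le (Or.inl ((ENNReal.ofReal_pos.2 hpos).ne')) (Or.inl ENNReal.ofReal_ne_top),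
      mul_comm]
    exact h1
  refine (lintegral_mono_set hSQ).trans (h2.trans (le_of_eq ?_))
  rw [ENNReal.coe_nnreal_eq, ← ENNReal.ofReal_div_of_pos hpos]
  congr 1
  rw [show (2 : ℝ) * (1 / 2) = 1 by norm_num, Real.rpow_one]
  field_simp

/-- **Growth of a.e. slice pressure from the `D`-gauge (endpoint).**  If `p` is a.e.-strongly
measurable on the slab and `a D(a; 0) ≤ c` for all `a > 0`, then for a.e. `τ` in a bounded window
`(α, β)`, `β ≤ 0`, there is `A_τ ≥ 0` with `∫_{B_L} |p(τ)|^{3/2} ≤ A_τ L²` for all `L ≥ 1`: the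
weighted dyadic series `Σ_k 4^{−k} ∫_{B_{2^{k+k₀}}} |p(τ)|^{3/2}` is integrable in `τ` (Tonelli and
`∫∫_{(α,β)×B_{2^{k+k₀}}} |p|^{3/2} ≤ c 2^{k+k₀}`), hence finite for a.e. `τ`. [folklore] -/
theorem ae_slice_pressure_growth_of_gauge_half {c : ℝ≥0}
    (hpm : AEStronglyMeasurable (uncurry p)
      (volume.restrict (Iio (0 : ℝ) ×ˢ (univ : Set (EuclideanSpace ℝ (Fin 3))))))
    (hD : ∀ a : ℝ, 0 < a →
      ENNReal.ofReal (a ^ (2 * (1 / 2 : ℝ))) * cknD a (0 : ℝ × EuclideanSpace ℝ (Fin 3)) p ≤ (c : ℝ≥0∞))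
    {α β : ℝ} (hβ : β ≤ 0) :
    ∀ᵐ τ : ℝ, τ ∈ Ioo α β → ∃ A : ℝ, 0 ≤ A ∧ ∀ L : ℝ, 1 ≤ L →
      ∫⁻ y in ball (0 : EuclideanSpace ℝ (Fin 3)) L, ‖p τ y‖ₑ ^ (3 / 2 : ℝ) ≤
        ENNReal.ofReal (A * L ^ 2) := by
  obtain ⟨k₀, hk₀⟩ := pow_unbounded_of_one_lt |α| (by norm_num : (1 : ℝ) < 2)
  set I : Set ℝ := Ioo α β with hI
  have hI0 : I ⊆ Iio 0 := fun t ht => lt_of_lt_of_le ht.2 hβ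
  -- the radii `r k = 2^{k+k₀}`
  set r : ℕ → ℝ := fun k => (2 : ℝ) ^ (k + k₀) with hr
  have hr0 : ∀ k, 0 < r k := fun k => by positivity
  have hrα : ∀ k, -(r k ^ 2) ≤ α := by
    intro k
    have h1 : (2 : ℝ) ^ k₀ ≤ r k := pow_le_pow_right₀ (by norm_num) (by omega)
    have h1' : (1 : ℝ) ≤ r k := one_le_pow₀ (by norm_num)
    have h2 : r k ≤ r k ^ 2 := by nlinarith
    linarith [neg_abs_le α]
  have hJ : ∀ k, ∫⁻ z in I ×ˢ ball (0 : EuclideanSpace ℝ (Fin 3)) (r k), ‖p z.1 z.2‖ₑ ^ (3 / 2 : ℝ) ≤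
      ENNReal.ofReal (c * r k) :=
    fun k => lintegral_window_ball_rpow_le_of_gaugeD_half hD (hr0 k) (hrα k) hβ
  -- measurability on `I × ℝ³`
  have hprodI : (volume.restrict I).prod (volume : Measure (EuclideanSpace ℝ (Fin 3))) =
      volume.restrict (I ×ˢ (univ : Set (EuclideanSpace ℝ (Fin 3)))) := by
    rw [Measure.restrict_prod_eq_prod_univ, ← Measure.volume_eq_prod]
  have hpmI : AEStronglyMeasurable (uncurry p)
      ((volume.restrict I).prod (volume : Measure (EuclideanSpace ℝ (Fin 3)))) := by
    rw [hprodI]; exact hpm.mono_measure (Measure.restrict_mono (prod_mono hI0 subset_rfl) le_rfl)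
  set f : ℕ → ℝ × EuclideanSpace ℝ (Fin 3) → ℝ≥0∞ := fun k z =>
    ((univ : Set ℝ) ×ˢ ball (0 : EuclideanSpace ℝ (Fin 3)) (r k)).indicator
      (fun z => ‖p z.1 z.2‖ₑ ^ (3 / 2 : ℝ)) z with hf
  have hfm : ∀ k, AEMeasurable (f k) ((volume.restrict I).prod volume) := fun k =>
    (hpmI.aemeasurable.enorm.pow_const _).indicator (MeasurableSet.univ.prod measurableSet_ball)
  have hg : ∀ k τ, (∫⁻ y, f k (τ, y)) =
      ∫⁻ y in ball (0 : EuclideanSpace ℝ (Fin 3)) (r k), ‖p τ y‖ₑ ^ (3 / 2 : ℝ) := by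
    intro k τ
    rw [← lintegral_indicator measurableSet_ball]
    congr 1; funext y
    by_cases hy : y ∈ ball (0 : EuclideanSpace ℝ (Fin 3)) (r k)
    · rw [indicator_of_mem hy]
      exact indicator_of_mem (show (τ, y) ∈ (univ : Set ℝ) ×ˢ ball (0 : EuclideanSpace ℝ (Fin 3)) (r k)
        from ⟨mem_univ _, hy⟩) _
    · rw [indicator_of_notMem hy]
      exact indicator_of_notMem (fun h => hy h.2) _
  have hgm : ∀ k, AEMeasurable (fun τ => ∫⁻ y in ball (0 : EuclideanSpace ℝ (Fin 3)) (r k),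
      ‖p τ y‖ₑ ^ (3 / 2 : ℝ)) (volume.restrict I) := by
    intro k
    have h := (hfm k).lintegral_prod_right'
    simp_rw [hg] at h
    exact h
  -- Tonelli
  have hTon : ∀ k, ∫⁻ τ in I, ∫⁻ y in ball (0 : EuclideanSpace ℝ (Fin 3)) (r k), ‖p τ y‖ₑ ^ (3 / 2 : ℝ) =
      ∫⁻ z in I ×ˢ ball (0 : EuclideanSpace ℝ (Fin 3)) (r k), ‖p z.1 z.2‖ₑ ^ (3 / 2 : ℝ) := by
    intro k
    have h1 : ∫⁻ z, f k z ∂((volume.restrict I).prod volume) = ∫⁻ τ in I, ∫⁻ y, f k (τ, y) :=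
      lintegral_prod _ (hfm k)
    simp_rw [hg] at h1
    rw [← h1, hprodI, lintegral_indicator (MeasurableSet.univ.prod measurableSet_ball),
      Measure.restrict_restrict (MeasurableSet.univ.prod measurableSet_ball), prod_inter_prod,
      univ_inter, inter_univ]
  -- the weighted series
  set w : ℕ → ℝ≥0∞ := fun k => ENNReal.ofReal ((1 / 4 : ℝ) ^ k) with hw
  set G : ℝ → ℝ≥0∞ := fun τ => ∑' k, w k *
    ∫⁻ y in ball (0 : EuclideanSpace ℝ (Fin 3)) (r k), ‖p τ y‖ₑ ^ (3 / 2 : ℝ) with hG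
  have hGm : AEMeasurable G (volume.restrict I) :=
    AEMeasurable.tsum fun k => (hgm k).const_mul _
  have hGint : ∫⁻ τ in I, G τ ≠ ⊤ := by
    have h1 : ∫⁻ τ in I, G τ = ∑' k, w k *
        ∫⁻ z in I ×ˢ ball (0 : EuclideanSpace ℝ (Fin 3)) (r k), ‖p z.1 z.2‖ₑ ^ (3 / 2 : ℝ) := by
      rw [hG, lintegral_tsum fun k => (hgm k).const_mul _]
      congr 1; funext k
      rw [lintegral_const_mul'' _ (hgm k), hTon k]
    rw [h1]
    have h2 : ∀ k, w k * ∫⁻ z in I ×ˢ ball (0 : EuclideanSpace ℝ (Fin 3)) (r k),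
        ‖p z.1 z.2‖ₑ ^ (3 / 2 : ℝ) ≤ ENNReal.ofReal (c * 2 ^ k₀ * (1 / 2 : ℝ) ^ k) := by
      intro k
      calc w k * ∫⁻ z in I ×ˢ ball (0 : EuclideanSpace ℝ (Fin 3)) (r k), ‖p z.1 z.2‖ₑ ^ (3 / 2 : ℝ)
          ≤ w k * ENNReal.ofReal (c * r k) := mul_le_mul_right (hJ k) _
        _ = ENNReal.ofReal ((1 / 4 : ℝ) ^ k * (c * r k)) := by rw [hw, ← ENNReal.ofReal_mul (by positivity)]
        _ = ENNReal.ofReal (c * 2 ^ k₀ * (1 / 2 : ℝ) ^ k) := by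
            congr 1
            have e : (1 / 4 : ℝ) ^ k * 2 ^ k = (1 / 2 : ℝ) ^ k := by rw [← mul_pow]; norm_num
            calc (1 / 4 : ℝ) ^ k * (c * r k) = c * 2 ^ k₀ * ((1 / 4 : ℝ) ^ k * 2 ^ k) := by
                  rw [hr]; ring
              _ = _ := by rw [e]
    refine ne_of_lt (lt_of_le_of_lt (ENNReal.tsum_le_tsum h2) ?_)
    rw [← ENNReal.ofReal_tsum_of_nonneg (fun k => by positivity)
      ((summable_geometric_of_lt_one (by norm_num) (by norm_num)).mul_left _)]
    exact ENNReal.ofReal_lt_top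
  have hae := ae_lt_top' hGm hGint
  rw [ae_restrict_iff' measurableSet_Ioo] at hae
  filter_upwards [hae] with τ hτ hτI
  have hGτ := hτ hτI
  refine ⟨4 * (G τ).toReal, by positivity, fun L hL => ?_⟩
  have hL0 : 0 < L := by linarith
  obtain ⟨n, hn1, hn2⟩ := exists_nat_pow_near hL (by norm_num : (1 : ℝ) < 2)
  have hLr : L ≤ r (n + 1) :=
    hn2.le.trans (pow_le_pow_right₀ (by norm_num) (by omega))
  have hk : w (n + 1) * ∫⁻ y in ball (0 : EuclideanSpace ℝ (Fin 3)) (r (n + 1)), ‖p τ y‖ₑ ^ (3 / 2 : ℝ) ≤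
      G τ := ENNReal.le_tsum (n + 1)
  have hw0 : w (n + 1) ≠ 0 := (ENNReal.ofReal_pos.2 (by positivity)).ne'
  have hwinv : (w (n + 1))⁻¹ = ENNReal.ofReal ((4 : ℝ) ^ (n + 1)) := by
    rw [hw]
    show (ENNReal.ofReal ((1 / 4 : ℝ) ^ (n + 1)))⁻¹ = ENNReal.ofReal ((4 : ℝ) ^ (n + 1))
    rw [← ENNReal.ofReal_inv_of_pos (by positivity), ← inv_pow, one_div, inv_inv]
  have h4L : (4 : ℝ) ^ (n + 1) ≤ 4 * L ^ 2 := by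
    have e : (4 : ℝ) ^ n = (2 ^ n) ^ 2 := by
      rw [← pow_mul, show (4 : ℝ) = 2 ^ 2 by norm_num, ← pow_mul, mul_comm]
    rw [pow_succ, e]
    have : (0 : ℝ) ≤ 2 ^ n := by positivity
    nlinarith
  calc ∫⁻ y in ball (0 : EuclideanSpace ℝ (Fin 3)) L, ‖p τ y‖ₑ ^ (3 / 2 : ℝ)
      ≤ ∫⁻ y in ball (0 : EuclideanSpace ℝ (Fin 3)) (r (n + 1)), ‖p τ y‖ₑ ^ (3 / 2 : ℝ) :=
        lintegral_mono_set (ball_subset_ball hLr)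
    _ = (w (n + 1))⁻¹ * (w (n + 1) *
          ∫⁻ y in ball (0 : EuclideanSpace ℝ (Fin 3)) (r (n + 1)), ‖p τ y‖ₑ ^ (3 / 2 : ℝ)) := by
        rw [← mul_assoc, ENNReal.inv_mul_cancel hw0 ENNReal.ofReal_ne_top, one_mul]
    _ ≤ (w (n + 1))⁻¹ * G τ := mul_le_mul_right hk _
    _ ≤ ENNReal.ofReal (4 * L ^ 2) * G τ := by
        rw [hwinv]; exact mul_le_mul_left (ENNReal.ofReal_le_ofReal h4L) _
    _ = ENNReal.ofReal (4 * (G τ).toReal * L ^ 2) := by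
        rw [show 4 * (G τ).toReal * L ^ 2 = (4 * L ^ 2) * (G τ).toReal by ring,
          ENNReal.ofReal_mul (by positivity : (0 : ℝ) ≤ 4 * L ^ 2), ENNReal.ofReal_toReal hGτ.ne]

end PressureGrowth

section SliceRiesz

variable {u : ℝ → EuclideanSpace ℝ (Fin 3) → EuclideanSpace ℝ (Fin 3)}
  {p : ℝ → EuclideanSpace ℝ (Fin 3) → ℝ}

/-- **A.e. slice pressure is the scale-wise Riesz pressure of the slice (endpoint, class).**
Let `(u, p)` be a suitable weak Euler/NS pair on the slab with the `A`- and `D`-gauges at `ρ = 1/2`,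
and let the slices on a window `(α, β)`, `β < 0`, obey `|u(τ, y)| ≤ C_up |y|^{1−δ}` a.e. on
`|y| ≥ R₀` (`−2/3 ≤ δ ≤ 1`).  Then for a.e. `τ ∈ (α, β)` and every `R ≥ 1`, a.e. on `B_{R/2}`:
`p(τ) = Π[u(τ)·1_{B_R}] + ∫_{|z| ≥ R} K(·−z)(u(τ, z)) dz`.  (Slice Poisson identity, `D`-gauge growth
`∫_{B_L}|p(τ)| ≲ L^{7/3}`, cubic growth `≲ L^{5/3}` from the far-field bound, and the lineage's
`pressure_ae_eq_scaleQ_of_poisson` with `σ = 2/3`.) [cite: Seregin2014, §6.6 p. 129] -/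
theorem ae_slice_riesz_of_gauge_half {ν : ℝ} {c : ℝ≥0}
    (hsw : IsSuitableWeakSolutionOn (slab (EuclideanSpace ℝ (Fin 3)) (Iio 0) isOpen_Iio) ν 0 u p)
    (hA : ∀ a : ℝ, 0 < a →
      ENNReal.ofReal (a ^ (2 * (1 / 2 : ℝ))) * cknA a (0 : ℝ × EuclideanSpace ℝ (Fin 3)) u ≤ (c : ℝ≥0∞))
    (hD : ∀ a : ℝ, 0 < a →
      ENNReal.ofReal (a ^ (2 * (1 / 2 : ℝ))) * cknD a (0 : ℝ × EuclideanSpace ℝ (Fin 3)) p ≤ (c : ℝ≥0∞))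
    {α β : ℝ} (hβ : β < 0)
    {δ Cup R₀ : ℝ} (hδ1 : δ ≤ 1) (hδm : -(2 / 3 : ℝ) ≤ δ) (hCup : 0 ≤ Cup)
    (hup : ∀ᵐ τ : ℝ, τ ∈ Ioo α β → ∀ᵐ y ∂volume, R₀ ≤ ‖y‖ → ‖u τ y‖ ≤ Cup * ‖y‖ ^ (1 - δ)) :
    ∀ᵐ τ : ℝ, τ ∈ Ioo α β → ∀ R : ℝ, 1 ≤ R → ∀ᵐ y ∂volume, ‖y‖ < R / 2 →
      p τ y = rieszPressure ((ball (0 : EuclideanSpace ℝ (Fin 3)) R).indicator (u τ)) y +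
        ∫ z in {z | R ≤ ‖z‖}, pressureKernel (y - z) (u τ z) := by
  have hum : AEStronglyMeasurable (uncurry u)
      (volume.restrict (Iio (0 : ℝ) ×ˢ (univ : Set (EuclideanSpace ℝ (Fin 3))))) := by
    obtain ⟨G, hG, -, -⟩ := hsw.localEnergy
    simpa [slab] using hG.locallyIntegrableOn.aestronglyMeasurable
  have hpm : AEStronglyMeasurable (uncurry p)
      (volume.restrict (Iio (0 : ℝ) ×ˢ (univ : Set (EuclideanSpace ℝ (Fin 3))))) := by
    simpa [slab] using hsw.distributional.2.2.1.aestronglyMeasurable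
  have h1 := ae_slice_aestronglyMeasurable hum
  have h2 := ae_slice_energy_of_gauge_half hum hA
  have h3 := ae_slice_cube_locallyIntegrable hsw
  have h4 := ae_slice_pressure_locallyIntegrable hsw
  have h5 := ae_slice_pressure_growth_of_gauge_half hpm hD hβ.le (α := α)
  -- the slice pressure Poisson identity on `(α, β) × ℝ³`
  set Q : Opens (ℝ × EuclideanSpace ℝ (Fin 3)) :=
    ⟨Ioo α β ×ˢ ((⊤ : Opens (EuclideanSpace ℝ (Fin 3))) : Set (EuclideanSpace ℝ (Fin 3))),
      isOpen_Ioo.prod (⊤ : Opens (EuclideanSpace ℝ (Fin 3))).isOpen⟩ with hQ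
  have hQle : Q ≤ slab (EuclideanSpace ℝ (Fin 3)) (Iio 0) isOpen_Iio := by
    intro z hz
    have hz' : z ∈ Ioo α β ×ˢ ((⊤ : Opens (EuclideanSpace ℝ (Fin 3))) :
        Set (EuclideanSpace ℝ (Fin 3))) := hz
    exact mem_slab.2 (lt_trans (mem_prod.1 hz').1.2 hβ)
  have hns : IsDistributionalNSSolutionOn Q ν 0 u p := hsw.distributional.of_le hQle
  have h6 := IsDistributionalNSSolutionOn.ae_forall_slice_pressure_identity
    (a := α) (b := β) (Ω := (⊤ : Opens (EuclideanSpace ℝ (Fin 3)))) hns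
    (by
      have e : (uncurry (0 : ℝ → EuclideanSpace ℝ (Fin 3) → EuclideanSpace ℝ (Fin 3))) =
          fun _ => 0 := by funext z; rfl
      rw [e]; exact locallyIntegrableOn_zero) (fun φ _ => by simp)
  rw [ae_restrict_iff' measurableSet_Ioo] at h6
  filter_upwards [h1, h2, h3, h4, h5, h6, hup] with τ h1τ h2τ h3τ h4τ h5τ h6τ hupτ hτI
  have hτ0 : τ < 0 := hτI.2.trans hβ
  have hm := h1τ hτ0
  obtain ⟨hi2, -⟩ := h2τ hτ0
  have hc3 := h3τ hτ0
  have hp1 := h4τ hτ0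
  obtain ⟨A, hA0, hAg⟩ := h5τ hτI
  have hpmτ : AEStronglyMeasurable (p τ) volume := hp1.aestronglyMeasurable
  -- the Poisson identity of the slice
  have hPoisson : ∀ θ : EuclideanSpace ℝ (Fin 3) → ℝ, ContDiff ℝ (⊤ : ℕ∞) θ → HasCompactSupport θ →
      ∫ y, p τ y * (Δ θ) y = -∫ y, fderiv ℝ (fderiv ℝ θ) y (u τ y) (u τ y) := by
    intro θ hθ hθc
    have hs1 : AEStronglyMeasurable (u τ)
        (volume.restrict ((⊤ : Opens (EuclideanSpace ℝ (Fin 3))) : Set (EuclideanSpace ℝ (Fin 3)))) := by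
      rw [Opens.coe_top, Measure.restrict_univ]; exact hm
    have hs2 : LocallyIntegrableOn (fun x => ‖u τ x‖ ^ 2)
        ((⊤ : Opens (EuclideanSpace ℝ (Fin 3))) : Set (EuclideanSpace ℝ (Fin 3))) volume := by
      rw [Opens.coe_top, locallyIntegrableOn_univ]; exact hi2.locallyIntegrable
    have hs3 : LocallyIntegrableOn (p τ)
        ((⊤ : Opens (EuclideanSpace ℝ (Fin 3))) : Set (EuclideanSpace ℝ (Fin 3))) volume := by
      rw [Opens.coe_top, locallyIntegrableOn_univ]; exact hp1
    exact h6τ hτI hs1 hs2 hs3 θ ⟨hθ, hθc, by simp⟩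
  -- growth bounds (`σ = 2/3`)
  set v₁ : ℝ := volume.real (ball (0 : EuclideanSpace ℝ (Fin 3)) 1) with hv₁
  have hv₁0 : 0 ≤ v₁ := measureReal_nonneg
  set AP : ℝ := A ^ (2 / 3 : ℝ) * v₁ ^ (1 / 3 : ℝ) with hAP
  set AV : ℝ := (∫ y in closedBall (0 : EuclideanSpace ℝ (Fin 3)) |R₀|, ‖u τ y‖ ^ 3) +
    Cup * ∫ z, ‖u τ z‖ ^ 2 with hAV
  have hAP0 : 0 ≤ AP := by positivity
  have hAV0 : 0 ≤ AV := add_nonneg (setIntegral_nonneg measurableSet_closedBall fun y _ => by positivity)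
    (mul_nonneg hCup (integral_nonneg fun z => by positivity))
  have hPg : ∀ L : ℝ, 1 ≤ L → ∫ y in ball (0 : EuclideanSpace ℝ (Fin 3)) L, |p τ y| ≤
      max AP AV * L ^ (3 - (2 / 3 : ℝ)) := by
    intro L hL
    have hL0 : 0 < L := by linarith
    have h := setIntegral_abs_le_of_lintegral_ball hpmτ (M := A * L ^ 2) (by positivity) hL0 (hAg L hL)
    have e1 : (A * L ^ 2) ^ (2 / 3 : ℝ) = A ^ (2 / 3 : ℝ) * L ^ (4 / 3 : ℝ) := by
      rw [Real.mul_rpow hA0 (by positivity), ← Real.rpow_natCast L 2, ← Real.rpow_mul hL0.le]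
      norm_num
    have e2 : (L ^ 3 * v₁) ^ (1 / 3 : ℝ) = L * v₁ ^ (1 / 3 : ℝ) := by
      rw [Real.mul_rpow (by positivity) hv₁0, ← Real.rpow_natCast L 3, ← Real.rpow_mul hL0.le]
      norm_num
    have e3 : L ^ (4 / 3 : ℝ) * L = L ^ (3 - (2 / 3 : ℝ)) := by
      rw [← Real.rpow_add_one hL0.ne']; norm_num
    calc ∫ y in ball (0 : EuclideanSpace ℝ (Fin 3)) L, |p τ y|
        ≤ (A * L ^ 2) ^ (2 / 3 : ℝ) * (L ^ 3 * v₁) ^ (1 / 3 : ℝ) := h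
      _ = AP * L ^ (3 - (2 / 3 : ℝ)) := by rw [e1, e2, ← e3, hAP]; ring
      _ ≤ max AP AV * L ^ (3 - (2 / 3 : ℝ)) :=
          mul_le_mul_of_nonneg_right (le_max_left _ _) (by positivity)
  have hVg : ∀ L : ℝ, 1 ≤ L → ∫ y in ball (0 : EuclideanSpace ℝ (Fin 3)) L, ‖u τ y‖ ^ 3 ≤
      max AP AV * L ^ (3 - (2 / 3 : ℝ)) := by
    intro L hL
    calc ∫ y in ball (0 : EuclideanSpace ℝ (Fin 3)) L, ‖u τ y‖ ^ 3 ≤ AV * L ^ (5 / 3 : ℝ) :=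
          setIntegral_cube_le_of_sublinear hi2 hc3 hδ1 hδm hCup (hupτ hτI) hL
      _ ≤ AV * L ^ (3 - (2 / 3 : ℝ)) :=
          mul_le_mul_of_nonneg_left (Real.rpow_le_rpow_of_exponent_le hL (by norm_num)) hAV0
      _ ≤ max AP AV * L ^ (3 - (2 / 3 : ℝ)) :=
          mul_le_mul_of_nonneg_right (le_max_right _ _) (by positivity)
  intro R hR
  exact pressure_ae_eq_scaleQ_of_poisson hm hi2 hc3 hp1 hPoisson (σ := 2 / 3) (by norm_num) (by norm_num)
    (le_max_of_le_left hAP0) hPg hVg (by linarith)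

end SliceRiesz

end Summit.NavierStokesRegularity.NavierStokesRegularity.Theorems.PowerGaugeEulerLiouville
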